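import Literature.AnabelianGeometry.EtaleTheta.SettingModelTateDeltaTheta
import Literature.AnabelianGeometry.EtaleTheta.SettingModelChiKummerData
import Literature.AnabelianGeometry.EtaleTheta.SettingModelThetaCentreZHat
import Literature.AnabelianGeometry.EtaleTheta.SettingModelGfpRigidity
import Literature.AnabelianGeometry.EtaleTheta.SettingModelKummerCocyclePTate
import Literature.AnabelianGeometry.EtaleTheta.SettingModelChiTate2
import HarnessLib

/-!
# The stage-2 («Tate shear») model: `(ê, ê_b)`-coordinates of the ell-kernel, the Galois action on them, and the
# Kummer exponent of the `a`-axis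

abc-iut cell, layer L2, R78 cluster STAGE 2 (integrator abc-iut-L6-d6, R78-MAP #5), seat abc-iut-w5-d051 (gen 3;
author of the Tate-module clauses TM / TM₂ of abc-iut-L2-t6's `IsTateOrigin` / `IsThm16Origin`). Mochizuki, *The étale
theta function …*, Publ. RIMS **45** (2009) [EtTh], §1 p. 13 [cite: MochizukiEtTh2009, §1 p.13]: «`(Δ^tp_Y)^ell ≅ Ẑ(1)`»,
«`G_{K_N}` acts trivially on `(Δ^tp_X)^ell/N·(Δ^tp_Y)^ell`», `K_N = K(ζ_N, q_X^{1/N})` — i.e. the Galois action on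
`(Δ^tp_X)^ell` is upper triangular: cyclotomic character on `Ẑ(1)·b̄`, Kummer cocycle of `q_X` in the corner.

Carrier-level facts for abc-iut-w5-d249's stage-2 carrier `PiTpχq p i j = Γ ⋊_{(κ_p^i, κ_p^j, χ)} G_{ℚ_p}`
(`SettingModelTateSemidirect`), over abc-iut-L6-d6's `mem_ellKerχq_iff` (`SettingModelTateDeltaTheta`),
abc-iut-w5-d029's `eHatB`, abc-iut-w5-d171's `hHat_y_eq_modN_eHatB`, abc-iut-L2-t6's `affTwist₃`/`shear`,
abc-iut-L2-t5's `kappaP`/`pRoot`/`cycGen` — everything BY NAME, PROOF-ONLY (no definition, no named fact):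

* `inl_mem_ellKerχq_iff` — `inl q ∈ Ker(Π^tp_X ↠ (Π^tp_X)^ell) ↔ ê(pr₁ q) = 1 ∧ ê_b(pr₁ q) = 1`;
* `conj_inl_eqq` — `g · inl q · g⁻¹ = inl(g.left · (σ·q) · g.left⁻¹)`, `σ = g.right`;
* **`eHatB_gfpFst_actχq_of_gfpSnd_eq_one`** — on `Δ^tp_Y` (degree `0`) the stage-2 action multiplies the
  `b`-exponent by `χ(σ)` (from abc-iut-L2-t6's level law `hHat_gfpFst_affTwist₃Gfp_of_gfpSnd_eq_one`) — the typed
  sentence «`(Δ^tp_Y)^ell ≅ Ẑ(1)`»;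
* **`eHatB_gfpFst_actχq_eta_a`** — on the lift `(η a, 1)` of `1 ∈ Z` the action has `b`-exponent `κ_p(σ)^j`
  («the Kummer cocycle in the corner»), `eHat_gfpFst_actχq` — and `a`-exponent unchanged;
* `apply_pRoot_sq` — `σ((p^{1/N})²) = ζ_N^{2c} (p^{1/N})²` with `c = κ_p(σ) mod N`, and `natCast_eq_two_mul_of_pow_eq`
  — if `σ r = ζ_N^m r` for `r = (p^{1/N})²` then `m ≡ 2·κ_p(σ) (mod N)`: the Kummer class of `q_X = p²` is `2κ_p`.

Consumer: `SettingModelTateOrigin` (`IsTateOrigin` HOLDS at `ThetaSetting.modelχq p i 2`). Semi-synthetic model =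
consistency evidence only; nothing of [EtTh] is asserted; no side is taken on [IUTchIII] Cor. 3.12; typed ≠ proved.
-/

noncomputable section

namespace Literature.AnabelianGeometry.EtaleTheta.SettingModel

open Literature.AnabelianGeometry.SemiGraphs Function Topology

/-! ### 1. Ẑ bookkeeping -/

/-- `Ẑ` is commutative. [folklore] -/
private theorem zh_mul_comm' (a b : ZH) : a * b = b * a := by
  apply Subtype.ext
  funext N
  change a.val N * b.val N = b.val N * a.val N
  have key : ∀ u v : Multiplicative ℤ ⧸ N.toSubgroup, u * v = v * u := fun u v => _root_.mul_comm u v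
  exact key (a.val N) (b.val N)

/-- `ê_b` is invariant under `Inn(b^t)` (private copy of abc-iut-w5-d171's `eHatB_innB`, `SettingModelTateYCoord`,
kept local so that this file does not wait for that module's olean). [cite: MochizukiEtTh2009, §1 p.12] -/
private theorem eHatB_innB' (t : ZH) (x : F₂hatT) : eHatB (innB t x) = eHatB x := by
  rw [innB_apply, map_mul, map_mul, map_inv, zh_mul_comm' (eHatB (bPow t)), mul_assoc, mul_inv_cancel, mul_one]

section Carrier

variable (p : ℕ) [Fact p.Prime] (i j : ℤ)

/-! ### 2. The ell-kernel of `curveχq` in the coordinates `(ê, ê_b)` -/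

/-- **`inl q ∈ Ker(Π^tp_X ↠ (Π^tp_X)^ell)` iff `ê(pr₁ q) = 1` and `ê_b(pr₁ q) = 1`** (stage-2 carrier).
[cite: MochizukiEtTh2009, §1 p.12] -/
theorem inl_mem_ellKerχq_iff (q : Gfp) :
    (SemidirectProduct.inl q : PiTpχq p i j) ∈ CurveTheta.ellKer (curveχq p i j) ↔
      eHat (gfpFst q) = 1 ∧ eHatB (gfpFst q) = 1 := by
  rw [mem_ellKerχq_iff, SemidirectProduct.left_inl, SemidirectProduct.right_inl]
  constructor
  · rintro ⟨h, -⟩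
    refine ⟨zh_eq_one_of_forall_level fun N => ?_, zh_eq_one_of_forall_level fun N => ?_⟩
    · rw [← modN_eq_level, ← hHat_x_eq_modN_eHat, (h N).1, ofAdd_zero]
    · rw [← modN_eq_level, ← hHat_y_eq_modN_eHatB, (h N).2, ofAdd_zero]
  · rintro ⟨hx, hy⟩
    refine ⟨fun N => ⟨hHat_x_eq_zero_of_eHat_eq_one N hx, ?_⟩, rfl⟩
    have h := hHat_y_eq_modN_eHatB N (gfpFst q)
    rw [hy, map_one] at h
    exact ofAdd_eq_one.mp h

/-- An element with trivial Galois component is `inl` of its `Γ`-component. [cite: MochizukiEtTh2009, §1 p.12] -/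
theorem eq_inl_of_right_eq_oneq {g : PiTpχq p i j} (hg : g.right = 1) : g = SemidirectProduct.inl g.left :=
  SemidirectProduct.ext (by simp) (by simp [hg])

/-- Conjugation of a `Δ`-element in `Π^tp_X = Γ ⋊ G_{ℚ_p}` (stage 2):
`g · inl q · g⁻¹ = inl (g.left · θ(g.right) q · g.left⁻¹)`. [cite: MochizukiEtTh2009, §1 p.12] -/
theorem conj_inl_eqq (g : PiTpχq p i j) (q : Gfp) :
    g * SemidirectProduct.inl q * g⁻¹ = SemidirectProduct.inl (g.left * actχq p i j g.right q * g.left⁻¹) := by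
  have h1 : (SemidirectProduct.inr g.right : PiTpχq p i j) * SemidirectProduct.inl q *
      (SemidirectProduct.inr g.right)⁻¹ = SemidirectProduct.inl (actχq p i j g.right q) := by
    rw [← map_inv, ← SemidirectProduct.inl_aut]
  calc g * SemidirectProduct.inl q * g⁻¹
      = (SemidirectProduct.inl g.left * SemidirectProduct.inr g.right) * SemidirectProduct.inl q *
          (SemidirectProduct.inl g.left * SemidirectProduct.inr g.right)⁻¹ := by
        rw [SemidirectProduct.inl_left_mul_inr_right]
    _ = SemidirectProduct.inl g.left *
          ((SemidirectProduct.inr g.right : PiTpχq p i j) * SemidirectProduct.inl q *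
            (SemidirectProduct.inr g.right)⁻¹) *
          (SemidirectProduct.inl g.left)⁻¹ := by group
    _ = SemidirectProduct.inl (g.left * actχq p i j g.right q * g.left⁻¹) := by
        rw [h1, ← map_inv, ← map_mul, ← map_mul]

/-! ### 3. The stage-2 Galois action in coordinates -/

/-- The `a`-exponent is invariant under the stage-2 action. [cite: MochizukiEtTh2009, §1 p.13] -/
theorem eHat_gfpFst_actχq (σ : GQp p) (q : Gfp) : eHat (gfpFst (actχq p i j σ q)) = eHat (gfpFst q) := by
  rw [gfpFst_actχq, eHat_actHatχq]

/-- **«`(Δ^tp_Y)^ell ≅ Ẑ(1)`» at stage 2**: on the degree-`0` part `Δ^tp_Y` of `Γ` the action multiplies the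
`b`-exponent by the cyclotomic character, `ê_b(σ·q) = χ(σ)(ê_b q)` (abc-iut-L2-t6's level law read at every
level, then level determination). [cite: MochizukiEtTh2009, §1 p.13] -/
theorem eHatB_gfpFst_actχq_of_gfpSnd_eq_one (σ : GQp p) {q : Gfp} (hq : gfpSnd q = 1) :
    eHatB (gfpFst (actχq p i j σ q)) = chi p σ (eHatB (gfpFst q)) := by
  refine ZHatLevel.ext_of_level fun N => ?_
  have hlev := hHat_gfpFst_affTwist₃Gfp_of_gfpSnd_eq_one N (kappaP p σ ^ i) (kappaP p σ ^ j) (chi p σ) hq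
  have hy := congrArg (fun h : Heis (ZMod N) => Multiplicative.ofAdd h.y) hlev
  simp only [Heis.diagTwist_apply] at hy
  rw [actχq_apply, ← modN_eq_level, ← hHat_y_eq_modN_eHatB, hy, ← modN_eq_level]
  apply Multiplicative.toAdd.injective
  rw [toAdd_ofAdd, modN_eq_level, ZHatLevel.toAdd_level_aut, ← modN_eq_level, ← hHat_y_eq_modN_eHatB, toAdd_ofAdd]

/-- The graph element `(η a, 1) ∈ Γ` of the generator `a`. [cite: MochizukiEtTh2009, §1 p.12] -/
theorem eta_a_mem_Gfpq :
    ((eta (FreeGroup.of 0), Multiplicative.ofAdd (1 : ℤ)) : F₂hatT × Multiplicative ℤ) ∈ Gfp := by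
  have h := eta_mk_mem_Gfp (FreeGroup.of 0)
  rwa [expA_apply, heisHom_of_zero] at h

/-- **«The Kummer cocycle in the corner»**: the stage-2 action sends the lift `(η a, 1)` of `1 ∈ Z` to an element
with `b`-exponent `κ_p(σ)^j` (`θ_χ` fixes `a`, the shear appends `b^{κ_p(σ)^j}`, the inner part is invisible to
`ê_b`). [cite: MochizukiEtTh2009, §1 p.13] -/
theorem eHatB_gfpFst_actχq_eta_a (σ : GQp p) :
    eHatB (gfpFst (actχq p i j σ ⟨(eta (FreeGroup.of 0), Multiplicative.ofAdd (1 : ℤ)), eta_a_mem_Gfpq⟩)) =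
      kappaP p σ ^ j := by
  rw [gfpFst_actχq, actHatχq_apply, affTwist₃_apply, eHatB_innB', gfpFst_apply]
  change eHatB (shear (kappaP p σ ^ j) (twist (chi p σ) (eta (FreeGroup.of 0)))) = _
  rw [twist_eta_of_zero, shear_eta_of_zero, map_mul, eHatB_eta_of_zero, one_mul, eHatB_bPow]

/-- The `a`-exponent of the same element is `ι 1`. [cite: MochizukiEtTh2009, §1 p.13] -/
theorem eHat_gfpFst_actχq_eta_a (σ : GQp p) :
    eHat (gfpFst (actχq p i j σ ⟨(eta (FreeGroup.of 0), Multiplicative.ofAdd (1 : ℤ)), eta_a_mem_Gfpq⟩)) =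
      iotaZ (Multiplicative.ofAdd 1) := by
  rw [eHat_gfpFst_actχq, gfpFst_apply]
  change eHat (eta (FreeGroup.of 0)) = _
  rw [eHat_eta, expA_apply, heisHom_of_zero]

/-! ### 4. The Kummer class of `q_X = p²` at the chosen roots -/

/-- **`σ((p^{1/N})²) = ζ_N^{2c}·(p^{1/N})²`** with `c = κ_p(σ) mod N` and `ζ_N` the chosen generator of `μ_N`
(abc-iut-L2-t5's `apply_pRoot`). [cite: NeukirchANT1999, Ch. IV §3] -/
theorem apply_pRoot_sq (σ : GQp p) (N : ℕ+) :
    σ (pRoot p N ^ 2) =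
      (((cycGen p : ℕ+ → (PadicAlgCl p)ˣ) N : (PadicAlgCl p)ˣ) : PadicAlgCl p) ^
          (2 * (Multiplicative.toAdd (ZHatLevel.level N (kappaP p σ))).val) * pRoot p N ^ 2 := by
  rw [map_pow, apply_pRoot, mul_pow, ← pow_mul, mul_comm _ 2]

/-- **The Kummer class of `q_X = p²` is `2κ_p`**: if `σ r = ζ_N^m · r` for `r = (p^{1/N})²`, then
`m ≡ 2·κ_p(σ) (mod N)`. [cite: NeukirchANT1999, Ch. IV §3] -/
theorem natCast_eq_two_mul_of_apply_eq (σ : GQp p) (N : ℕ+) {m : ℕ}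
    (h : σ (pRoot p N ^ 2) =
      (((cycGen p : ℕ+ → (PadicAlgCl p)ˣ) N : (PadicAlgCl p)ˣ) : PadicAlgCl p) ^ m * pRoot p N ^ 2) :
    (m : ZMod N) = 2 * Multiplicative.toAdd (ZHatLevel.level N (kappaP p σ)) := by
  haveI : NeZero (N : ℕ) := ⟨N.ne_zero⟩
  set ζ := (((cycGen p : ℕ+ → (PadicAlgCl p)ˣ) N : (PadicAlgCl p)ˣ) : PadicAlgCl p) with hζdef
  set c := (Multiplicative.toAdd (ZHatLevel.level N (kappaP p σ))).val with hc
  have hζ : IsPrimitiveRoot ζ (N : ℕ) := isPrimitiveRoot_coe_cycGen p N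
  have hr0 : pRoot p N ^ 2 ≠ 0 := pow_ne_zero 2 (pRoot_ne_zero p N)
  rw [apply_pRoot_sq] at h
  have hpow : ζ ^ (2 * c) = ζ ^ m := mul_right_cancel₀ hr0 h
  have hmod : (2 * c) % (N : ℕ) = m % (N : ℕ) := by
    rw [← pow_mod_orderOf ζ (2 * c), ← pow_mod_orderOf ζ m, ← hζ.eq_orderOf] at hpow
    exact hζ.pow_inj (Nat.mod_lt _ N.pos) (Nat.mod_lt _ N.pos) hpow
  have hcast : ((2 * c : ℕ) : ZMod N) = (m : ZMod N) := (ZMod.natCast_eq_natCast_iff' _ _ _).mpr hmod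
  rw [← hcast, Nat.cast_mul, Nat.cast_ofNat, hc, ZMod.natCast_zmod_val]

end Carrier

end Literature.AnabelianGeometry.EtaleTheta.SettingModel

end
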